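import Literature.Computability.Cryptography.SISOddPart
import Literature.Computability.Cryptography.SISOddPartMachine
import Literature.Computability.Cryptography.GapSVPToSIS
import Literature.Computability.Complexity.PromiseCookReductionsProofs
import Literature.Algebra.EuclideanLattices.GapCVPPrimeMachine
import HarnessLib

/-!
# Micciancio–Regev 2007, Thm. 5.23 with Lemmas 5.22 and 5.5: `GapSVP → SIS` for odd moduli, from the SIS′ form

Topic `Computability/Cryptography` (family `pqc`), namespace `Literature.Computability.Cryptography`.
The `GapSVP → SIS` form of Micciancio–Regev's worst-case/average-case connection — "By Lemma 5.22
this also implies a reduction from GapSVP_γ to SIS′ (**or SIS when the modulus `q` is odd**)"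
(authors' full version p. 28, right before Thm. 5.23), the parenthesis being MR07 **Lemma 5.5**
(p. 18): an oracle solving SIS_{q,m,β} on the average is turned, for odd `q`, into an oracle
solving SIS′_{q,m,β} on the average with at least the same success probability, by a
polynomial-time post-processing — is NOT a separate named fact of the tree (D-0026 split review,
2026-08-15: it was a decomposition child of `owfExist_of_gapSVP_worstCaseHard` whose only
unproved content duplicated that of its sibling `MicciancioRegev2007_gapSVP_to_SIS'`, namely
MR07 Thm. 5.23 proper, `MicciancioRegev2007_gapCVP'_to_SIS'`; the former
`def MicciancioRegev2007_gapSVP_to_SIS : Prop` of `SIS.lean` is merged back). It is recorded here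
as the explicit conclusion of PROVED theorems. With the mathematics of Lemma 5.5
(`SIS.IsSolution.oddPart`, `SISOddPart.lean`) and its machine (`SIS.OddPartFP.oddPartFn ∈ FP`
acting correctly on every output string, `SISOddPartMachine.lean`) this file proves:

* `SIS.decodeIntVec_oddPartFn` — the bridge: the vector read off `oddPartFn w` is
  `SIS.oddPart` of the vector read off `w` (definitional unfolding of the machine's statement);
* the SIS′ solver `B.postMap oddPartFn` of Lemma 5.5 (`B` followed by `oddPartFn`, same coins;
  `RandAlg.postMap` of `SISOddPart.lean`): it is PPT when `B` is (`SIS.isPPT_postMap_oddPartFn`)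
  and, for odd `q`, its SIS′ success probability in every dimension is at least the SIS success
  probability of `B` (`SIS.successProb_le_successProb'_postMap_oddPartFn`: event inclusion under
  the same coins);
* **`MicciancioRegev2007_gapSVP_to_SIS_of_SIS'`**: the SIS′ form of MR07 Thm. 5.23 (with
  Lemma 5.22), `MicciancioRegev2007_gapSVP_to_SIS'` (`SIS.lean`), implies the SIS form for odd
  moduli, stated in full in the rendering of `SIS.lean` (parameters `q, m, β` polynomially
  bounded and polynomial-time computable, `β > 0`, the Micciancio–Regev modulus condition,
  `∀ n, Odd (q n)`; a PPT `B` solving SIS_{q(n),m(n),β(n)} on the average with probability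
  `≥ 1/n^c` for every `n ∈ S` puts GapSVP_{14π√n β} restricted to dimensions `n ∈ S`, `n ≥ n₀`
  into textbook promise-BPP);
* **`MicciancioRegev2007_gapSVP_to_SIS_of_gapCVP'`**: hence the SIS form follows from MR07
  Thm. 5.23 proper alone (`MicciancioRegev2007_gapCVP'_to_SIS'`, `GapSVPToSIS.lean`), the other two
  leaves of `MicciancioRegev2007_gapSVP_to_SIS'_of_cook` being discharged in the tree
  (`PromiseProblem.mem_PromiseBPP'_of_cookReducible_holds`, `gmssAlg_isPolyTime_holds`).

So the SIS form for odd moduli rests on exactly the same single unproved theorem as its SIS′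
twin: Theorem 5.23 proper (the Gaussian-measure reduction GapCVP′ → SIS′).

## References

* D. Micciancio, O. Regev, *Worst-case to average-case reductions based on Gaussian measures*,
  SIAM J. Comput. 37(1) (2007) 267–302; authors' full version: Def. 5.4 (p. 17), Lemma 5.5
  (p. 18), Lemma 5.22 (p. 27), remark and Thm. 5.23 (p. 28) [MicciancioRegev2007].
* O. Goldreich, *On promise problems: a survey*, LNCS 3895 (2006), §1.2 Def. 3 and remark
  (Cook reductions to promise problems in BPP) [Goldreich2006].
-/

noncomputable section

open Computability Literature.Computability.Complexity Literature.Algebra.EuclideanLattices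
  Literature.Computability.Cryptography.LWE

namespace Literature.Computability.Cryptography

namespace SIS

open OddPartFP

/-- **The machine computes the odd part**: for every dimension `m` and every string `w`, the
vector read off `oddPartFn w` is `oddPart` of the vector read off `w` (the statement of
`OddPartFP.decodeIntVec_oddPartFn`, whose right-hand side is `SIS.oddPart` unfolded).
[cite: MicciancioRegev2007, Lemma 5.5 (proof, full version p. 18)] -/
theorem decodeIntVec_oddPartFn (m : ℕ) (w : List Bool) :
    decodeIntVec m (oddPartFn w) = oddPart (decodeIntVec m w) :=
  OddPartFP.decodeIntVec_oddPartFn m w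

/-- The SIS′ solver of MR07 Lemma 5.5 built from an SIS solver `B` — run `B`, then divide its
answer by the largest power of two dividing all coordinates (`B.postMap oddPartFn`, same coins) —
is PPT when `B` is (post-processing by the `FP` function `oddPartFn`). [Micciancio–Regev 2007,
Lemma 5.5 and the remark before Thm. 5.23 ("or SIS when the modulus `q` is odd")] [cite: MicciancioRegev2007, Lemma 5.5 (full version p. 18)] -/
theorem isPPT_postMap_oddPartFn {B : RandAlg (List Bool) (List Bool)} (hB : IsPPT B id) :
    IsPPT (B.postMap oddPartFn) id :=
  RandAlg.isPolyTime_postMap hB oddPartFn_mem_FP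

/-- **Lemma 5.5 on the average**: for an odd modulus, the SIS′ success probability of the
transformed solver is at least the SIS success probability of `B`, instance by instance and hence
on the average over `A ∈ ℤ_q^{n×m}` (same coins; every run of `B` printing an SIS solution becomes
a run printing an SIS′ solution). [cite: MicciancioRegev2007, Lemma 5.5 (full version p. 18)] -/
theorem successProb_le_successProb'_postMap_oddPartFn (B : RandAlg (List Bool) (List Bool))
    (n m q : ℕ) [NeZero q] (β : ℝ) (hq : Odd q) :
    successProb B n m q β ≤ successProb' (B.postMap oddPartFn) n m q β := by
  refine matrixAvg_mono fun A => ?_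
  rw [RandAlg.pr_postMap]
  refine B.pr_mono _ _ fun w hw => ?_
  change IsSolution' A β (decodeIntVec m (oddPartFn w))
  rw [decodeIntVec_oddPartFn]
  exact IsSolution.oddPart hw hq

end SIS

open SIS SIS.OddPartFP

/-- **MR07 Thm. 5.23 with Lemmas 5.22 and 5.5 from Thm. 5.23 with Lemma 5.22** ("or SIS when the
modulus `q` is odd", authors' full version p. 28): the SIS′ form `MicciancioRegev2007_gapSVP_to_SIS'`
gives the SIS form for odd moduli — for polynomially bounded, polynomial-time computable
parameters `q, m, β` (`β > 0`) under the Micciancio–Regev modulus condition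
`q(n) ≥ 4 √(m(n)) n^{1.5} β(n)` with every `q(n)` odd, if a PPT algorithm `B` solves
SIS_{q(n),m(n),β(n)} on the average with probability `≥ 1/n^c` for every dimension `n ∈ S`, then
for some `n₀` the promise problem GapSVP_γ, `γ(n) = 14π √n β(n)`, restricted to instances of
dimension `n ∈ S`, `n ≥ n₀`, lies in textbook promise-BPP. Proof: feed the SIS′ fact the
transformed solver `B.postMap oddPartFn` (Lemma 5.5), which is PPT and succeeds on SIS′ with
probability `≥ 1/n^c` on every `n ∈ S` where `B` does on SIS.
[cite: MicciancioRegev2007, Thm. 5.23 (with Lemmas 5.22, 5.5; full version pp. 18, 27–28)] -/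
theorem MicciancioRegev2007_gapSVP_to_SIS_of_SIS' (h : MicciancioRegev2007_gapSVP_to_SIS')
    (q m : ℕ → ℕ) [∀ n, NeZero (q n)] (β : ℕ → ℝ) (hq : IsPolyBounded q) (hm : IsPolyBounded m)
    (hβ : IsPolyBoundedReal β) (hpar : IsPolyTimeParams q β m) (hβ0 : ∀ n, 0 < β n)
    (hmod : MRModulusCondition q m β) (hodd : ∀ n, Odd (q n))
    (B : RandAlg (List Bool) (List Bool)) (hB : IsPPT B id) (c : ℕ) (S : Set ℕ)
    (hS : ∀ n ∈ S, 1 / (n : ℝ) ^ c ≤ successProb B n (m n) (q n) (β n)) :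
    ∃ n₀ : ℕ, PromiseProblem.ofEncoding gapSVPInstanceEncoding
        {p | p ∈ GapSVP.yes (mrGamma β) ∧ p.1.n ∈ S ∩ Set.Ici n₀}
        {p | p ∈ GapSVP.no (mrGamma β) ∧ p.1.n ∈ S ∩ Set.Ici n₀} ∈ PromiseBPP' :=
  h q m β hq hm hβ hpar hβ0 hmod (B.postMap oddPartFn) (isPPT_postMap_oddPartFn hB) c S
    fun n hn => (hS n hn).trans
      (successProb_le_successProb'_postMap_oddPartFn B n (m n) (q n) (β n) (hodd n))

/-- **The SIS form for odd moduli from Thm. 5.23 proper**: with the machine-level Lemma 5.22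
(`MicciancioRegev2007_gapSVP_to_SIS'_of_cook`, whose generic leaves
`PromiseProblem.mem_PromiseBPP'_of_cookReducible` and `gmssAlg_isPolyTime` are discharged in the
tree) the `GapSVP → SIS` statement for odd moduli follows from
`MicciancioRegev2007_gapCVP'_to_SIS'` (MR07 Thm. 5.23 as printed, GapCVP′ → SIS′) alone.
[cite: MicciancioRegev2007, Thm. 5.23 (with Lemmas 5.22, 5.5; full version pp. 18, 27–28)] -/
theorem MicciancioRegev2007_gapSVP_to_SIS_of_gapCVP' (h : MicciancioRegev2007_gapCVP'_to_SIS')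
    (q m : ℕ → ℕ) [∀ n, NeZero (q n)] (β : ℕ → ℝ) (hq : IsPolyBounded q) (hm : IsPolyBounded m)
    (hβ : IsPolyBoundedReal β) (hpar : IsPolyTimeParams q β m) (hβ0 : ∀ n, 0 < β n)
    (hmod : MRModulusCondition q m β) (hodd : ∀ n, Odd (q n))
    (B : RandAlg (List Bool) (List Bool)) (hB : IsPPT B id) (c : ℕ) (S : Set ℕ)
    (hS : ∀ n ∈ S, 1 / (n : ℝ) ^ c ≤ successProb B n (m n) (q n) (β n)) :
    ∃ n₀ : ℕ, PromiseProblem.ofEncoding gapSVPInstanceEncoding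
        {p | p ∈ GapSVP.yes (mrGamma β) ∧ p.1.n ∈ S ∩ Set.Ici n₀}
        {p | p ∈ GapSVP.no (mrGamma β) ∧ p.1.n ∈ S ∩ Set.Ici n₀} ∈ PromiseBPP' :=
  MicciancioRegev2007_gapSVP_to_SIS_of_SIS' (MicciancioRegev2007_gapSVP_to_SIS'_of_cook h
    PromiseProblem.mem_PromiseBPP'_of_cookReducible_holds gmssAlg_isPolyTime_holds)
    q m β hq hm hβ hpar hβ0 hmod hodd B hB c S hS

end Literature.Computability.Cryptography

end
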